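import Literature.AlgebraicGeometry.Motives.HodgeStructureCentralizerCenterFactorsStable
import Literature.AlgebraicGeometry.Motives.HodgeStructureLefschetzGroupEigenblocksFieldExtension
import HarnessLib

/-!
# «`C'(A) ≅ C(A) ⊗_k k'`» IS TRANSITIVE IN A TOWER `ℚ ⊆ K ⊆ L ⊆ M`: THE RING HOMOMORPHISMS `Z(C(H)(K)) → Z(C(H)(L)) → Z(C(H)(M))`
# OVER `j` COMPOSE TO THE ONE OVER `j_{K→M} = j_{L→M} ∘ j_{K→L}`, THE CONTRACTIONS `MaxSpec(Z_M) → MaxSpec(Z_L) → MaxSpec(Z_K)`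
# COMPOSE, `t_K ≤ t_L ≤ t_M`, AND `t_K = t_M` IFF NO FACTOR OF `C₀ ⊗ K` SPLITS IN `L` NOR ANY FACTOR OF `C₀ ⊗ L` IN `M`
# (Milne 1999 §1 Remark 1.6, §2 p. 646 «`F ⊗_ℚ k = F₁ × ⋯ × F_t`»)

[topic AlgebraicGeometry/Motives]

Layer `Literature/AlgebraicGeometry/Motives`, lane `lit-hodgefound` (Track 2 foundations library; prover seat
`lit-hodgefound-p02`, generation 57, self-proposed row g57-#2; successor-menu item (ii) «TOWER FUNCTORIALITY `k ⊆ k′ ⊆ k″`» of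
generation 56). THEOREMS ONLY: no definition, no named fact (net debt `0`), no instance, no notation.

Milne's Remark 1.6 — «if `k'` is a field containing `k`, then `X ↦ H*(X) ⊗_k k'` is a Weil cohomology theory with coefficient
field `k'` … there are canonical isomorphisms `C'(A) ≅ C(A) ⊗_k k'`, `S'(A) ≅ S(A)_{/k'}`» — applies to `k ⊆ k'` and again to
`k' ⊆ k''`, and `(C(A) ⊗_k k') ⊗_{k'} k'' = C(A) ⊗_k k''`: the comparison isomorphisms are TRANSITIVE.  Generation 56 typed the
one-step theory on the tree's carrier (a `ℚ`-Hodge structure `H` on `V`, fields `ℚ ⊆ K ⊆ L`, `j = extendScalars K L V`,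
`Z_K = Z(C(H)(K))` the centre of the commutant of `E_φ ⊗ K` in `End_K(K ⊗ V)`, `t_K = #MaxSpec(Z_K)` the number of factor fields
of `C₀ ⊗ K`): the `L`-extension `F` of a `K`-endomorphism `f` through `F ∘ j = j ∘ f` (g56-#1), the injective ring homomorphism
`φ_{KL} : Z_K → Z_L` over `j` (g56-#1, stated as an existence), the SURJECTIVE contraction `𝔫 ↦ φ⁻¹(𝔫)`, `MaxSpec(Z_L) → MaxSpec(Z_K)`
(g56-#3), `t_K ≤ t_L` (g56-#1) and `t_K = t_L ⟺` the contraction is bijective (g56-#11); g56-#5 has `j_{L→M} ∘ j_{K→L} = j_{K→M}`.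
Here the TOWER `ℚ ⊆ K ⊆ L ⊆ M` is assembled, all PROVED:
(i) 2-OUT-OF-3 FOR EXTENSIONS: if `F` extends `f` along `K → L` and `G` extends `F` along `L → M`, then `G` extends `f` along
`K → M`; if `G` extends `f` along `K → M` and `F` extends `f` along `K → L`, then `G` extends `F` along `L → M` (two `L`-linear maps
agreeing on `j(K ⊗ V)`); if `G` extends both `F` (along `L → M`) and `f` (along `K → M`), then `F` extends `f` (`j_{L→M}` injective);
(ii) ring homomorphisms `Z_K → Z_L` over `j` are UNIQUE, hence **`φ_{LM} ∘ φ_{KL} = φ_{KM}`** for any three over their `j`'s, and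
such a compatible triple exists;
(iii) the contractions compose: `φ_{KM}⁻¹(𝔭) = φ_{KL}⁻¹(φ_{LM}⁻¹(𝔭))` on `MaxSpec`;
(iv) **`t_K ≤ t_L ≤ t_M`**, so `t_K = t_M ⟹ t_K = t_L = t_M`; (v) since all contractions are surjective, the `K → M` contraction is
bijective iff BOTH the `K → L` and the `L → M` contractions are — **`t_K = t_M` iff no factor of `C₀ ⊗ K` splits in `L` and no factor
of `C₀ ⊗ L` splits in `M`**; (vi) first kind: `#Z(S(H)(K)) = #Z(S(H)(M)) ⟺ #Z(S(H)(K)) = #Z(S(H)(L)) ∧ #Z(S(H)(L)) = #Z(S(H)(M))`.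

## The source, verbatim

J. S. Milne, *Lefschetz classes on abelian varieties*, Duke Math. J. **96** (1999) 639–675 [Milne1999LefschetzClasses]
(held `paper:doi-10-1215-s0012-7094-99-09620-5`; Duke page = folio + 638). p. 644 (p0006) L30–L37: «**Remark 1.6.** If
`X ↦ H*(X)` is a Weil cohomology theory with coefficient field `k`, and `k'` is a field containing `k`, then `X ↦ H*(X) ⊗_k k'` is
a Weil cohomology theory with coefficient field `k'`. If `C'(A)` and `S'(A)` denote the objects defined relative to the second
theory, then there are canonical isomorphisms `C'(A) ≅ C(A) ⊗_k k'`, `S'(A) ≅ S(A)_{/k'}`.»; p. 646 (p0008) L43–L45: «Let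
`F ⊗_ℚ k = F₁ × ⋯ × F_t`, be the decomposition of `F ⊗_ℚ k` into a product of fields, and let `1 = e₁ + ⋯ + e_t`, be the
corresponding decomposition of `1` into a sum of orthogonal idempotents.»
N. Bourbaki, *Algebra I* [BourbakiAlgebraI1989], Ch. II §5 no. 1 Prop. 2 (transitivity of extension of scalars) and no. 3
Prop. 7 (faithfulness over a field).
R. S. Pierce, *Associative Algebras* [Pierce1982], §10.7 Cor. b (commutative semisimple algebras: products of fields; behaviour of
the factors under scalar extension).

## Dictionary and what is PROVED

`j_{KL} = extendScalars K L V`; "`F` extends `f` along `K → L`" = `∀ x, F (j_{KL} x) = j_{KL} (f x)`; `Z_K` = `Subalgebra.center K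
(Subalgebra.centralizer K (baseChange K '' E_φ))`; "`φ : Z_K →+* Z_L` over `j`" = `∀ z x, (φ z).1.1 (j x) = j (z.1.1 x)`;
`t_K = Nat.card (MaximalSpectrum Z_K)`; the contraction along `φ` = `𝔫 ↦ ⟨𝔫.comap φ, _⟩`.

* §1 (namespace `Literature.AlgebraicGeometry.Motives`): **`extendScalars_comm_trans`**, **`extendScalars_comm_of_extendScalars_comm_trans`**,
  **`extendScalars_comm_of_extendScalars_comm_trans'`** (2-out-of-3), `bijective_comp_iff_of_surjective` (functions).
* §2 (namespace `….HodgeStructure`): **`center_centralizer_ringHom_eq_of_extendScalars_comm`** (uniqueness over `j`),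
  **`center_centralizer_ringHom_comp_eq_of_extendScalars_comm`** (`φ_{LM} ∘ φ_{KL} = φ_{KM}`),
  **`exists_center_centralizer_ringHom_tower`** (a compatible injective triple), **`comap_comap_center_centralizer_eq`**
  (contractions compose), **`natCard_maximalSpectrum_center_centralizer_le_le`** (`t_K ≤ t_L ≤ t_M`),
  **`natCard_maximalSpectrum_center_centralizer_eq_and_eq_of_eq`** (`t_K = t_M ⟹ t_K = t_L ∧ t_L = t_M`),
  **`natCard_maximalSpectrum_center_centralizer_eq_iff_eq_and_eq`**, **`comap_bijective_iff_of_tower`** ((v)),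
  **`Polarization.natCard_center_lefschetzGroupBaseChange_eq_iff_eq_and_eq_of_tower`** ((vi)).

NOT here: a Galois-theoretic description of the fibres of the contractions; the `L`-ALGEBRA structure `Z_K ⊗_K L ≅ Z_L`.

Nearest tree results, BY NAME: g56-#1 `exists_center_centralizer_ringHom_injective`, `linearMap_ext_of_extendScalars`,
`linearMap_eq_of_extendScalars_comm`, `natCard_maximalSpectrum_center_centralizer_le`; g56-#3
`comap_maximalSpectrum_center_centralizer_surjective`, `injective_of_ringHom_extendScalars_comm`; g56-#5
`extendScalars_extendScalars_tower`, `glExtendScalarsHom_comp_glExtendScalarsHom` (the GROUP side of the tower, already in the tree);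
g56-#11 `comap_maximalSpectrum_bijective_iff_natCard_eq`; g56-#2 `Polarization.natCard_center_lefschetzGroupBaseChange_eq_iff_natCard_maximalSpectrum_eq`.

## References

* [Milne1999LefschetzClasses] J. S. Milne, *Lefschetz classes on abelian varieties*, Duke Math. J. 96 (1999) 639–675, §1 Remark
  1.6 (p. 644) and §2 p. 646 L43–L45.
* [BourbakiAlgebraI1989] N. Bourbaki, *Algebra I*, Springer (1989), Ch. II §5 no. 1 Prop. 2, no. 3 Prop. 7.
* [Pierce1982] R. S. Pierce, *Associative Algebras*, GTM 88 (1982), §10.7 Cor. b.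
-/

noncomputable section

open scoped TensorProduct

namespace Literature.AlgebraicGeometry.Motives

universe u u' u'' v

/-! ## §1 Two-out-of-three for extensions along a tower `K ⊆ L ⊆ M` -/

section Tower

variable (K : Type u) (L : Type u') (M : Type u'') [Field K] [Field L] [Field M] [Algebra ℚ K] [Algebra ℚ L] [Algebra ℚ M]
  [Algebra K L] [Algebra L M] [Algebra K M] [IsScalarTower ℚ K L] [IsScalarTower ℚ L M] [IsScalarTower ℚ K M]
  [IsScalarTower K L M] (V : Type v) [AddCommGroup V] [Module ℚ V]

/-- **EXTENSIONS COMPOSE ALONG A TOWER**: if `F` extends `f` along `K → L` and `G` extends `F` along `L → M`, then `G` extends `f`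
along `K → M` (`j_{L→M} ∘ j_{K→L} = j_{K→M}`) — «`C'(A) ≅ C(A) ⊗_k k'`» applied twice is the comparison for `k ⊆ k''`.
[cite: Milne1999LefschetzClasses, §1 Remark 1.6 (p. 644)] [cite: BourbakiAlgebraI1989, Ch. II §5 no. 1 Prop. 2] -/
theorem extendScalars_comm_trans {f : Module.End K (K ⊗[ℚ] V)} {F : Module.End L (L ⊗[ℚ] V)} {G : Module.End M (M ⊗[ℚ] V)}
    (hF : ∀ x, F (extendScalars K L V x) = extendScalars K L V (f x))
    (hG : ∀ y, G (extendScalars L M V y) = extendScalars L M V (F y)) (x : K ⊗[ℚ] V) :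
    G (extendScalars K M V x) = extendScalars K M V (f x) := by
  rw [← extendScalars_extendScalars_tower K L M V x, hG, hF, extendScalars_extendScalars_tower]

/-- **IF `G` EXTENDS `f` ALONG `K → M` AND `F` EXTENDS `f` ALONG `K → L`, THEN `G` EXTENDS `F` ALONG `L → M`**: the two `L`-linear maps
`G ∘ j_{L→M}` and `j_{L→M} ∘ F` out of `L ⊗ V` agree on `j_{K→L}(K ⊗ V)`, which spans `L ⊗ V` over `L`.
[cite: Milne1999LefschetzClasses, §1 Remark 1.6 (p. 644)] [cite: BourbakiAlgebraI1989, Ch. II §5 no. 1 Prop. 2 and §7 no. 7] -/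
theorem extendScalars_comm_of_extendScalars_comm_trans {f : Module.End K (K ⊗[ℚ] V)} {F : Module.End L (L ⊗[ℚ] V)}
    {G : Module.End M (M ⊗[ℚ] V)} (hF : ∀ x, F (extendScalars K L V x) = extendScalars K L V (f x))
    (hG : ∀ x, G (extendScalars K M V x) = extendScalars K M V (f x)) (y : L ⊗[ℚ] V) :
    G (extendScalars L M V y) = extendScalars L M V (F y) := by
  have h : (G.restrictScalars L) ∘ₗ extendScalars L M V = extendScalars L M V ∘ₗ F := by
    refine linearMap_ext_of_extendScalars K L V fun x => ?_
    rw [LinearMap.comp_apply, LinearMap.comp_apply, LinearMap.restrictScalars_apply, extendScalars_extendScalars_tower, hG, hF,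
      extendScalars_extendScalars_tower]
  have h' := LinearMap.congr_fun h y
  rw [LinearMap.comp_apply, LinearMap.comp_apply, LinearMap.restrictScalars_apply] at h'
  exact h'

/-- **IF `G` EXTENDS `F` ALONG `L → M` AND `f` ALONG `K → M`, THEN `F` EXTENDS `f` ALONG `K → L`** (`j_{L→M}` is injective).
[cite: Milne1999LefschetzClasses, §1 Remark 1.6 (p. 644)] [cite: BourbakiAlgebraI1989, Ch. II §5 no. 3 Prop. 7] -/
theorem extendScalars_comm_of_extendScalars_comm_trans' {f : Module.End K (K ⊗[ℚ] V)} {F : Module.End L (L ⊗[ℚ] V)}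
    {G : Module.End M (M ⊗[ℚ] V)} (hGF : ∀ y, G (extendScalars L M V y) = extendScalars L M V (F y))
    (hG : ∀ x, G (extendScalars K M V x) = extendScalars K M V (f x)) (x : K ⊗[ℚ] V) :
    F (extendScalars K L V x) = extendScalars K L V (f x) := by
  refine extendScalars_injective L M V ?_
  rw [← hGF, extendScalars_extendScalars_tower, hG, extendScalars_extendScalars_tower]

end Tower

/-- For surjections `f`, `g`: `g ∘ f` is bijective iff both `f` and `g` are. [folklore] -/
private theorem bijective_comp_iff_of_surjective₅₇₂ {α β γ : Type*} {f : α → β} {g : β → γ} (hf : Function.Surjective f)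
    (hg : Function.Surjective g) : Function.Bijective (g ∘ f) ↔ Function.Bijective f ∧ Function.Bijective g := by
  refine ⟨fun h => ?_, fun h => h.2.comp h.1⟩
  have hfi : Function.Injective f := fun a b hab => h.1 (by rw [Function.comp_apply, Function.comp_apply, hab])
  refine ⟨⟨hfi, hf⟩, ⟨fun b b' hbb' => ?_, hg⟩⟩
  obtain ⟨a, rfl⟩ := hf b
  obtain ⟨a', rfl⟩ := hf b'
  rw [h.1 (show (g ∘ f) a = (g ∘ f) a' from hbb')]

namespace HodgeStructure

/-! ## §2 The centres along `K ⊆ L ⊆ M`: `φ_{LM} ∘ φ_{KL} = φ_{KM}`, contractions compose, `t_K ≤ t_L ≤ t_M` -/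

section Pair

variable (K : Type u) (L : Type u') [Field K] [Field L] [Algebra ℚ K] [Algebra ℚ L] [Algebra K L] [IsScalarTower ℚ K L]
  {V : Type v} [AddCommGroup V] [Module ℚ V] {n : ℤ} (H : HodgeStructure V n)

set_option maxSynthPendingDepth 4 in
/-- **A RING HOMOMORPHISM `Z_K → Z_L` OVER `j` IS UNIQUE** (`φ(z)` is THE `L`-extension of `z`: two `L`-endomorphisms extending `z` agree
on `j(K ⊗ V)`), so the «canonical isomorphism `C'(A) ≅ C(A) ⊗_k k'`» on the centres is canonical indeed.
[cite: Milne1999LefschetzClasses, §1 Remark 1.6 (p. 644)] [cite: BourbakiAlgebraI1989, Ch. II §7 no. 7] -/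
theorem center_centralizer_ringHom_eq_of_extendScalars_comm
    (φ ψ : Subalgebra.center K (Subalgebra.centralizer K
        ((fun a : Module.End ℚ V => a.baseChange K) '' (H.endAlg : Set (Module.End ℚ V)))) →+*
      Subalgebra.center L (Subalgebra.centralizer L
        ((fun a : Module.End ℚ V => a.baseChange L) '' (H.endAlg : Set (Module.End ℚ V)))))
    (hφ : ∀ z x, ((φ z).1.1 : Module.End L (L ⊗[ℚ] V)) (extendScalars K L V x) =
      extendScalars K L V ((z.1.1 : Module.End K (K ⊗[ℚ] V)) x))
    (hψ : ∀ z x, ((ψ z).1.1 : Module.End L (L ⊗[ℚ] V)) (extendScalars K L V x) =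
      extendScalars K L V ((z.1.1 : Module.End K (K ⊗[ℚ] V)) x)) :
    φ = ψ :=
  RingHom.ext fun z => Subtype.ext (Subtype.ext (linearMap_eq_of_extendScalars_comm K L V (hφ z) (hψ z)))

end Pair

section Triple

variable (K : Type u) (L : Type u') (M : Type u'') [Field K] [Field L] [Field M] [Algebra ℚ K] [Algebra ℚ L] [Algebra ℚ M]
  [Algebra K L] [Algebra L M] [Algebra K M] [IsScalarTower ℚ K L] [IsScalarTower ℚ L M] [IsScalarTower ℚ K M]
  [IsScalarTower K L M] {V : Type v} [AddCommGroup V] [Module ℚ V] [Module.Finite ℚ V] {n : ℤ} (H : HodgeStructure V n)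

set_option maxSynthPendingDepth 4 in
omit [Module.Finite ℚ V] in
/-- **`φ_{LM} ∘ φ_{KL} = φ_{KM}`: THE COMPARISON HOMOMORPHISMS OF THE CENTRES ARE TRANSITIVE IN A TOWER `ℚ ⊆ K ⊆ L ⊆ M`** — for ANY
ring homomorphisms `φ_{KL} : Z_K → Z_L`, `φ_{LM} : Z_L → Z_M`, `φ_{KM} : Z_K → Z_M` over the respective `j`'s
(`(C(A) ⊗_k k') ⊗_{k'} k'' = C(A) ⊗_k k''`): `φ_{LM}(φ_{KL}(z))` extends `z` along `K → M` (§1), and extensions are unique.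
[cite: Milne1999LefschetzClasses, §1 Remark 1.6 (p. 644)] [cite: BourbakiAlgebraI1989, Ch. II §5 no. 1 Prop. 2] -/
theorem center_centralizer_ringHom_comp_eq_of_extendScalars_comm
    (φKL : Subalgebra.center K (Subalgebra.centralizer K
        ((fun a : Module.End ℚ V => a.baseChange K) '' (H.endAlg : Set (Module.End ℚ V)))) →+*
      Subalgebra.center L (Subalgebra.centralizer L
        ((fun a : Module.End ℚ V => a.baseChange L) '' (H.endAlg : Set (Module.End ℚ V)))))
    (φLM : Subalgebra.center L (Subalgebra.centralizer L
        ((fun a : Module.End ℚ V => a.baseChange L) '' (H.endAlg : Set (Module.End ℚ V)))) →+*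
      Subalgebra.center M (Subalgebra.centralizer M
        ((fun a : Module.End ℚ V => a.baseChange M) '' (H.endAlg : Set (Module.End ℚ V)))))
    (φKM : Subalgebra.center K (Subalgebra.centralizer K
        ((fun a : Module.End ℚ V => a.baseChange K) '' (H.endAlg : Set (Module.End ℚ V)))) →+*
      Subalgebra.center M (Subalgebra.centralizer M
        ((fun a : Module.End ℚ V => a.baseChange M) '' (H.endAlg : Set (Module.End ℚ V)))))
    (hKL : ∀ z x, ((φKL z).1.1 : Module.End L (L ⊗[ℚ] V)) (extendScalars K L V x) =
      extendScalars K L V ((z.1.1 : Module.End K (K ⊗[ℚ] V)) x))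
    (hLM : ∀ z x, ((φLM z).1.1 : Module.End M (M ⊗[ℚ] V)) (extendScalars L M V x) =
      extendScalars L M V ((z.1.1 : Module.End L (L ⊗[ℚ] V)) x))
    (hKM : ∀ z x, ((φKM z).1.1 : Module.End M (M ⊗[ℚ] V)) (extendScalars K M V x) =
      extendScalars K M V ((z.1.1 : Module.End K (K ⊗[ℚ] V)) x)) :
    φLM.comp φKL = φKM :=
  center_centralizer_ringHom_eq_of_extendScalars_comm K M H _ _
    (fun z x => extendScalars_comm_trans K L M V (hKL z) (hLM (φKL z)) x) hKM

set_option maxSynthPendingDepth 4 in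
/-- **A COMPATIBLE TRIPLE EXISTS** (polarizable `H`): injective ring homomorphisms `φ_{KL}`, `φ_{LM}`, `φ_{KM}` of the centres over the
respective `j`'s with `φ_{KM} = φ_{LM} ∘ φ_{KL}` — the inclusions `C₀ ⊗ K ↪ C₀ ⊗ L ↪ C₀ ⊗ M` (g56-#1 for each step, and the previous
statement). [cite: Milne1999LefschetzClasses, §1 Remark 1.6 (p. 644) and p. 645 L2–L6 (`C₀`)] -/
theorem exists_center_centralizer_ringHom_tower (hH : H.IsPolarizable) :
    ∃ (φKL : Subalgebra.center K (Subalgebra.centralizer K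
        ((fun a : Module.End ℚ V => a.baseChange K) '' (H.endAlg : Set (Module.End ℚ V)))) →+*
        Subalgebra.center L (Subalgebra.centralizer L
        ((fun a : Module.End ℚ V => a.baseChange L) '' (H.endAlg : Set (Module.End ℚ V)))))
      (φLM : Subalgebra.center L (Subalgebra.centralizer L
        ((fun a : Module.End ℚ V => a.baseChange L) '' (H.endAlg : Set (Module.End ℚ V)))) →+*
        Subalgebra.center M (Subalgebra.centralizer M
        ((fun a : Module.End ℚ V => a.baseChange M) '' (H.endAlg : Set (Module.End ℚ V)))))
      (φKM : Subalgebra.center K (Subalgebra.centralizer K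
        ((fun a : Module.End ℚ V => a.baseChange K) '' (H.endAlg : Set (Module.End ℚ V)))) →+*
        Subalgebra.center M (Subalgebra.centralizer M
        ((fun a : Module.End ℚ V => a.baseChange M) '' (H.endAlg : Set (Module.End ℚ V))))),
      Function.Injective φKL ∧ Function.Injective φLM ∧ Function.Injective φKM ∧
      (∀ z x, ((φKL z).1.1 : Module.End L (L ⊗[ℚ] V)) (extendScalars K L V x) =
      extendScalars K L V ((z.1.1 : Module.End K (K ⊗[ℚ] V)) x)) ∧
      (∀ z x, ((φLM z).1.1 : Module.End M (M ⊗[ℚ] V)) (extendScalars L M V x) =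
      extendScalars L M V ((z.1.1 : Module.End L (L ⊗[ℚ] V)) x)) ∧
      (∀ z x, ((φKM z).1.1 : Module.End M (M ⊗[ℚ] V)) (extendScalars K M V x) =
      extendScalars K M V ((z.1.1 : Module.End K (K ⊗[ℚ] V)) x)) ∧
      φLM.comp φKL = φKM := by
  obtain ⟨φKL, hiKL, hKL⟩ := exists_center_centralizer_ringHom_injective K L H hH
  obtain ⟨φLM, hiLM, hLM⟩ := exists_center_centralizer_ringHom_injective L M H hH
  obtain ⟨φKM, hiKM, hKM⟩ := exists_center_centralizer_ringHom_injective K M H hH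
  exact ⟨φKL, φLM, φKM, hiKL, hiLM, hiKM, hKL, hLM, hKM,
    center_centralizer_ringHom_comp_eq_of_extendScalars_comm K L M H φKL φLM φKM hKL hLM hKM⟩

set_option maxSynthPendingDepth 4 in
omit [Algebra K L] [Algebra L M] [Algebra K M] [IsScalarTower ℚ K L] [IsScalarTower ℚ L M] [IsScalarTower ℚ K M]
  [IsScalarTower K L M] [Module.Finite ℚ V] in
/-- **THE CONTRACTIONS COMPOSE**: `φ_{KM}⁻¹(𝔭) = φ_{KL}⁻¹(φ_{LM}⁻¹(𝔭))` for every maximal ideal `𝔭` of `Z_M`, whenever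
`φ_{KM} = φ_{LM} ∘ φ_{KL}` — the factor of `C₀ ⊗ K` under a factor of `C₀ ⊗ M` is found through the intermediate factor of `C₀ ⊗ L`.
[cite: Milne1999LefschetzClasses, §1 Remark 1.6 (p. 644) and §2 p. 646 L43–L45] [cite: Pierce1982, §10.7 Cor. b] -/
theorem comap_comap_center_centralizer_eq
    (φKL : Subalgebra.center K (Subalgebra.centralizer K
        ((fun a : Module.End ℚ V => a.baseChange K) '' (H.endAlg : Set (Module.End ℚ V)))) →+*
      Subalgebra.center L (Subalgebra.centralizer L
        ((fun a : Module.End ℚ V => a.baseChange L) '' (H.endAlg : Set (Module.End ℚ V)))))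
    (φLM : Subalgebra.center L (Subalgebra.centralizer L
        ((fun a : Module.End ℚ V => a.baseChange L) '' (H.endAlg : Set (Module.End ℚ V)))) →+*
      Subalgebra.center M (Subalgebra.centralizer M
        ((fun a : Module.End ℚ V => a.baseChange M) '' (H.endAlg : Set (Module.End ℚ V)))))
    (φKM : Subalgebra.center K (Subalgebra.centralizer K
        ((fun a : Module.End ℚ V => a.baseChange K) '' (H.endAlg : Set (Module.End ℚ V)))) →+*
      Subalgebra.center M (Subalgebra.centralizer M
        ((fun a : Module.End ℚ V => a.baseChange M) '' (H.endAlg : Set (Module.End ℚ V)))))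
    (hcomp : φLM.comp φKL = φKM)
    (P : MaximalSpectrum (Subalgebra.center M (Subalgebra.centralizer M
        ((fun a : Module.End ℚ V => a.baseChange M) '' (H.endAlg : Set (Module.End ℚ V)))))) :
    (P.asIdeal.comap φLM).comap φKL = P.asIdeal.comap φKM := by
  rw [Ideal.comap_comap, hcomp]

set_option maxSynthPendingDepth 4 in
omit [Algebra K M] [IsScalarTower ℚ K M] [IsScalarTower K L M] in
/-- **`t_K ≤ t_L ≤ t_M` IN A TOWER** (polarizable `H`; g56-#1 for each step): the number of factor fields of `C₀ ⊗ k` is monotone in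
`k`. [cite: Milne1999LefschetzClasses, §1 Remark 1.6 (p. 644) and §2 p. 646 L43–L45] -/
theorem natCard_maximalSpectrum_center_centralizer_le_le (hH : H.IsPolarizable) :
    Nat.card (MaximalSpectrum (Subalgebra.center K (Subalgebra.centralizer K
        ((fun a : Module.End ℚ V => a.baseChange K) '' (H.endAlg : Set (Module.End ℚ V)))))) ≤
        Nat.card (MaximalSpectrum (Subalgebra.center L (Subalgebra.centralizer L
        ((fun a : Module.End ℚ V => a.baseChange L) '' (H.endAlg : Set (Module.End ℚ V)))))) ∧
      Nat.card (MaximalSpectrum (Subalgebra.center L (Subalgebra.centralizer L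
        ((fun a : Module.End ℚ V => a.baseChange L) '' (H.endAlg : Set (Module.End ℚ V)))))) ≤
        Nat.card (MaximalSpectrum (Subalgebra.center M (Subalgebra.centralizer M
        ((fun a : Module.End ℚ V => a.baseChange M) '' (H.endAlg : Set (Module.End ℚ V)))))) :=
  ⟨natCard_maximalSpectrum_center_centralizer_le K L H hH, natCard_maximalSpectrum_center_centralizer_le L M H hH⟩

set_option maxSynthPendingDepth 4 in
omit [Algebra K M] [IsScalarTower ℚ K M] [IsScalarTower K L M] in
/-- **`t_K = t_M ⟹ t_K = t_L = t_M`**: if no factor of `C₀ ⊗ K` splits in `M`, none splits in the intermediate field `L` (squeeze).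
[cite: Milne1999LefschetzClasses, §1 Remark 1.6 (p. 644) and §2 p. 646 L43–L45] -/
theorem natCard_maximalSpectrum_center_centralizer_eq_and_eq_of_eq (hH : H.IsPolarizable)
    (h : Nat.card (MaximalSpectrum (Subalgebra.center K (Subalgebra.centralizer K
        ((fun a : Module.End ℚ V => a.baseChange K) '' (H.endAlg : Set (Module.End ℚ V)))))) =
      Nat.card (MaximalSpectrum (Subalgebra.center M (Subalgebra.centralizer M
        ((fun a : Module.End ℚ V => a.baseChange M) '' (H.endAlg : Set (Module.End ℚ V))))))) :
    Nat.card (MaximalSpectrum (Subalgebra.center K (Subalgebra.centralizer K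
        ((fun a : Module.End ℚ V => a.baseChange K) '' (H.endAlg : Set (Module.End ℚ V)))))) =
        Nat.card (MaximalSpectrum (Subalgebra.center L (Subalgebra.centralizer L
        ((fun a : Module.End ℚ V => a.baseChange L) '' (H.endAlg : Set (Module.End ℚ V)))))) ∧
      Nat.card (MaximalSpectrum (Subalgebra.center L (Subalgebra.centralizer L
        ((fun a : Module.End ℚ V => a.baseChange L) '' (H.endAlg : Set (Module.End ℚ V)))))) =
        Nat.card (MaximalSpectrum (Subalgebra.center M (Subalgebra.centralizer M
        ((fun a : Module.End ℚ V => a.baseChange M) '' (H.endAlg : Set (Module.End ℚ V)))))) := by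
  obtain ⟨h₁, h₂⟩ := natCard_maximalSpectrum_center_centralizer_le_le K L M H hH
  omega

set_option maxSynthPendingDepth 4 in
omit [Algebra K M] [IsScalarTower ℚ K M] [IsScalarTower K L M] in
/-- **`t_K = t_M ⟺ (t_K = t_L ∧ t_L = t_M)`** in a tower `ℚ ⊆ K ⊆ L ⊆ M` (polarizable `H`).
[cite: Milne1999LefschetzClasses, §1 Remark 1.6 (p. 644) and §2 p. 646 L43–L45] -/
theorem natCard_maximalSpectrum_center_centralizer_eq_iff_eq_and_eq (hH : H.IsPolarizable) :
    Nat.card (MaximalSpectrum (Subalgebra.center K (Subalgebra.centralizer K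
        ((fun a : Module.End ℚ V => a.baseChange K) '' (H.endAlg : Set (Module.End ℚ V)))))) =
        Nat.card (MaximalSpectrum (Subalgebra.center M (Subalgebra.centralizer M
        ((fun a : Module.End ℚ V => a.baseChange M) '' (H.endAlg : Set (Module.End ℚ V)))))) ↔
      Nat.card (MaximalSpectrum (Subalgebra.center K (Subalgebra.centralizer K
        ((fun a : Module.End ℚ V => a.baseChange K) '' (H.endAlg : Set (Module.End ℚ V)))))) =
          Nat.card (MaximalSpectrum (Subalgebra.center L (Subalgebra.centralizer L
        ((fun a : Module.End ℚ V => a.baseChange L) '' (H.endAlg : Set (Module.End ℚ V)))))) ∧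
        Nat.card (MaximalSpectrum (Subalgebra.center L (Subalgebra.centralizer L
        ((fun a : Module.End ℚ V => a.baseChange L) '' (H.endAlg : Set (Module.End ℚ V)))))) =
          Nat.card (MaximalSpectrum (Subalgebra.center M (Subalgebra.centralizer M
        ((fun a : Module.End ℚ V => a.baseChange M) '' (H.endAlg : Set (Module.End ℚ V)))))) :=
  ⟨natCard_maximalSpectrum_center_centralizer_eq_and_eq_of_eq K L M H hH, fun h => h.1.trans h.2⟩

set_option maxSynthPendingDepth 4 in
/-- **THE `K → M` CONTRACTION IS BIJECTIVE IFF BOTH THE `K → L` AND THE `L → M` CONTRACTIONS ARE** (polarizable `H`; any ring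
homomorphisms `φ_{KL}`, `φ_{LM}`, `φ_{KM}` over the `j`'s, and any maps `c` on maximal spectra with `c(𝔫) = φ⁻¹(𝔫)` — they exist and
are SURJECTIVE by g56-#3): `c_{KM} = c_{KL} ∘ c_{LM}` (`φ_{KM} = φ_{LM} ∘ φ_{KL}`), and a composite of surjections is bijective iff
both are — no factor of `C₀ ⊗ K` splits in `M` iff none splits in `L` and no factor of `C₀ ⊗ L` splits in `M` (g56-#11: bijective ⟺
`t` preserved). [cite: Milne1999LefschetzClasses, §1 Remark 1.6 (p. 644) and §2 p. 646 L43–L45] [cite: Pierce1982, §10.7 Cor. b] -/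
theorem comap_bijective_iff_of_tower (hH : H.IsPolarizable)
    (φKL : Subalgebra.center K (Subalgebra.centralizer K
        ((fun a : Module.End ℚ V => a.baseChange K) '' (H.endAlg : Set (Module.End ℚ V)))) →+*
      Subalgebra.center L (Subalgebra.centralizer L
        ((fun a : Module.End ℚ V => a.baseChange L) '' (H.endAlg : Set (Module.End ℚ V)))))
    (φLM : Subalgebra.center L (Subalgebra.centralizer L
        ((fun a : Module.End ℚ V => a.baseChange L) '' (H.endAlg : Set (Module.End ℚ V)))) →+*
      Subalgebra.center M (Subalgebra.centralizer M
        ((fun a : Module.End ℚ V => a.baseChange M) '' (H.endAlg : Set (Module.End ℚ V)))))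
    (φKM : Subalgebra.center K (Subalgebra.centralizer K
        ((fun a : Module.End ℚ V => a.baseChange K) '' (H.endAlg : Set (Module.End ℚ V)))) →+*
      Subalgebra.center M (Subalgebra.centralizer M
        ((fun a : Module.End ℚ V => a.baseChange M) '' (H.endAlg : Set (Module.End ℚ V)))))
    (hKL : ∀ z x, ((φKL z).1.1 : Module.End L (L ⊗[ℚ] V)) (extendScalars K L V x) =
      extendScalars K L V ((z.1.1 : Module.End K (K ⊗[ℚ] V)) x))
    (hLM : ∀ z x, ((φLM z).1.1 : Module.End M (M ⊗[ℚ] V)) (extendScalars L M V x) =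
      extendScalars L M V ((z.1.1 : Module.End L (L ⊗[ℚ] V)) x))
    (hKM : ∀ z x, ((φKM z).1.1 : Module.End M (M ⊗[ℚ] V)) (extendScalars K M V x) =
      extendScalars K M V ((z.1.1 : Module.End K (K ⊗[ℚ] V)) x))
    (cKL : MaximalSpectrum (Subalgebra.center L (Subalgebra.centralizer L
        ((fun a : Module.End ℚ V => a.baseChange L) '' (H.endAlg : Set (Module.End ℚ V))))) →
      MaximalSpectrum (Subalgebra.center K (Subalgebra.centralizer K
        ((fun a : Module.End ℚ V => a.baseChange K) '' (H.endAlg : Set (Module.End ℚ V))))))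
    (cLM : MaximalSpectrum (Subalgebra.center M (Subalgebra.centralizer M
        ((fun a : Module.End ℚ V => a.baseChange M) '' (H.endAlg : Set (Module.End ℚ V))))) →
      MaximalSpectrum (Subalgebra.center L (Subalgebra.centralizer L
        ((fun a : Module.End ℚ V => a.baseChange L) '' (H.endAlg : Set (Module.End ℚ V))))))
    (cKM : MaximalSpectrum (Subalgebra.center M (Subalgebra.centralizer M
        ((fun a : Module.End ℚ V => a.baseChange M) '' (H.endAlg : Set (Module.End ℚ V))))) →
      MaximalSpectrum (Subalgebra.center K (Subalgebra.centralizer K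
        ((fun a : Module.End ℚ V => a.baseChange K) '' (H.endAlg : Set (Module.End ℚ V))))))
    (hcKL : ∀ I', (cKL I').asIdeal = I'.asIdeal.comap φKL) (hcLM : ∀ I', (cLM I').asIdeal = I'.asIdeal.comap φLM)
    (hcKM : ∀ I', (cKM I').asIdeal = I'.asIdeal.comap φKM) :
    Function.Bijective cKM ↔ Function.Bijective cKL ∧ Function.Bijective cLM := by
  have hcomp := center_centralizer_ringHom_comp_eq_of_extendScalars_comm K L M H φKL φLM φKM hKL hLM hKM
  -- the contractions are surjective (g56-#3), transported to the given `c`'s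
  have hsKL : Function.Surjective cKL := by
    obtain ⟨hmax, hs⟩ := comap_maximalSpectrum_center_centralizer_surjective K L H hH φKL hKL
    exact fun I => (hs I).imp fun I' h => MaximalSpectrum.ext ((hcKL I').trans (congrArg MaximalSpectrum.asIdeal h))
  have hsLM : Function.Surjective cLM := by
    obtain ⟨hmax, hs⟩ := comap_maximalSpectrum_center_centralizer_surjective L M H hH φLM hLM
    exact fun I => (hs I).imp fun I' h => MaximalSpectrum.ext ((hcLM I').trans (congrArg MaximalSpectrum.asIdeal h))
  have heq : cKM = cKL ∘ cLM := by
    funext I'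
    refine MaximalSpectrum.ext ?_
    rw [hcKM, Function.comp_apply, hcKL, hcLM]
    exact (comap_comap_center_centralizer_eq K L M H φKL φLM φKM hcomp I').symm
  rw [heq]
  exact bijective_comp_iff_of_surjective₅₇₂ hsLM hsKL |>.trans and_comm

set_option maxSynthPendingDepth 4 in
omit [Algebra K M] [IsScalarTower ℚ K M] [IsScalarTower K L M] in
/-- **FIRST KIND: `#Z(S(H)(K)) = #Z(S(H)(M)) ⟺ #Z(S(H)(K)) = #Z(S(H)(L)) ∧ #Z(S(H)(L)) = #Z(S(H)(M))`** — the finite centres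
`Z(S(H)(k)) ≅ {±1}^{t_k}` grow along `K ⊆ L ⊆ M` (g56-#2: `#Z(S(H)(K)) = #Z(S(H)(L)) ⟺ t_K = t_L`), so equality at the ends pins the
middle («`S'(A) ≅ S(A)_{/k'}`» in a tower). [cite: Milne1999LefschetzClasses, §1 Remark 1.6 (p. 644) and Prop. 1.7 (p. 645)] -/
theorem Polarization.natCard_center_lefschetzGroupBaseChange_eq_iff_eq_and_eq_of_tower {H : HodgeStructure V n} (ψ : Polarization H)
    (hfix : ∀ z : H.endAlg, z ∈ Subalgebra.center ℚ H.endAlg → ψ.adjoint (z : Module.End ℚ V) = z) :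
    Nat.card (Subgroup.center (ψ.lefschetzGroupBaseChange K)) = Nat.card (Subgroup.center (ψ.lefschetzGroupBaseChange M)) ↔
      Nat.card (Subgroup.center (ψ.lefschetzGroupBaseChange K)) = Nat.card (Subgroup.center (ψ.lefschetzGroupBaseChange L)) ∧
        Nat.card (Subgroup.center (ψ.lefschetzGroupBaseChange L)) = Nat.card (Subgroup.center (ψ.lefschetzGroupBaseChange M)) := by
  rw [ψ.natCard_center_lefschetzGroupBaseChange_eq_iff_natCard_maximalSpectrum_eq K M hfix,
    ψ.natCard_center_lefschetzGroupBaseChange_eq_iff_natCard_maximalSpectrum_eq K L hfix,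
    ψ.natCard_center_lefschetzGroupBaseChange_eq_iff_natCard_maximalSpectrum_eq L M hfix]
  exact natCard_maximalSpectrum_center_centralizer_eq_iff_eq_and_eq K L M H ⟨ψ⟩

end Triple

end HodgeStructure

end Literature.AlgebraicGeometry.Motives
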